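import Literature.Analysis.FluidPDE.KNSSSwirlSupNonpos
import HarnessLib

/-!
# Lei–Ren–Zhang 2019, Theorem 1.2: swirl pairs with a bounded drift

Analysis/FluidPDE support file (all results proved; no definitions, no named facts) on the
discharge path of the named fact `Literature.Analysis.FluidPDE.leiRenZhang2019_liouville_swirl_rate`
(`SelfSimilarLiouville`; Z. Lei, X. Ren, Q. S. Zhang, *On ancient periodic solutions to
axially-symmetric Navier–Stokes equations*, arXiv:1902.11229, Theorem 1.2, proof in §4,
pp. 10–12).

The discharge follows the mechanism of the printed §4 (a weighted identity for the swirl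
`Γ = r v_θ`, whose main term comes from `Γ = 0` on the axis while `Γ² ≈ L²` away from it) in
the linear form of Koch–Nadirashvili–Seregin–Šverák's proof of their Theorem 5.3
(arXiv:0709.3599, p. 10, (5.10)–(5.20)): the swirl equation
`Γₜ + b·∇Γ + (2/r)∂ᵣΓ = ΔΓ` is tested against the axisymmetric cut-off `φ = ξ(r) η_L(z) ζ_T(s)`.
The tree has this argument for KNSS's *swirl pairs* (`IsKNSSSwirlPair`, `KNSSSwirlTransport`,
`KNSSSwirlSupNonpos`), whose drift obeys `r‖u‖ ≤ C_u`; for a bounded ancient solution the drift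
`b = U + β e_z` of (5.10) is merely **bounded**, `‖b‖ ≤ C_u`. This file re-proves, for pairs
`(F, V)` with a bounded drift and with the hypotheses kept unbundled (theorems only), the
pair calculus of those two files:

* `LRZPair.rescale` — scaling/translation covariance `F(t* + λ²(s − T), z̄e_z + λy)`,
  `λ V(…)` (KNSS (5.11)–(5.13); the drift bounds are multiplied by `λ`);
* `LRZPair.continuousOn_uncurry` — joint continuity of `F` (it vanishes on the axis);
* `LRZPair.lemma21_data` — the hypotheses of KNSS's Lemma 2.1 (`KNSS2009_lemma21`) for `F + m`
  on a region `Ω ⊆ {r > ρ}`, with the merged drift `V + (2/r)e_r` bounded by `C_u + 2/ρ`;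
* `LRZPair.slice_identity`, `LRZPair.time_identity`, `LRZPair.spaceTime_identity` — the swirl
  equation tested against `φ_{L,T}` (KNSS (5.15)–(5.19)):
  `∫∫ (F − M)(∂ₛφ + V·∇φ + Δφ) dy ds = −∫∫ (2/r) F φ_{,r} dy ds`.

The proofs are those of the tree's `IsKNSSSwirlPair.*` versions with the drift bound replaced
(on the support `{r ≤ 2}` of the cut-off a bounded drift satisfies `‖V‖ ≤ 2C_u/r`, so the
dominations are unchanged in form).

## References

* Z. Lei, X. Ren, Q. S. Zhang, arXiv:1902.11229, Theorem 1.2 and §4 (pp. 10–12). [LeiRenZhang2019]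
* G. Koch, N. Nadirashvili, G. Seregin, V. Šverák, Acta Math. 203 (2009) = arXiv:0709.3599,
  proof of Theorem 5.3, (5.10)–(5.20), p. 10; Lemma 2.1, p. 5. [KochNadirashviliSereginSverak2009]
-/

noncomputable section

open MeasureTheory Set Function Filter Topology TopologicalSpace InnerProductSpace WithLp
open scoped Laplacian RealInnerProductSpace ContDiff

namespace Literature.Analysis.FluidPDE

namespace LRZPair

variable {Cf Cu Cr τ : ℝ} {F : ℝ → (EuclideanSpace ℝ (Fin 3)) → ℝ} {V : ℝ → (EuclideanSpace ℝ (Fin 3)) → (EuclideanSpace ℝ (Fin 3))}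

/-! ### Scaling and translation covariance -/

section Rescale

/-- `|⟪v, e_r(x)⟫| ≤ ‖v‖`. [folklore] -/
theorem abs_inner_eR_le (v x : (EuclideanSpace ℝ (Fin 3))) : |⟪v, eR x⟫| ≤ ‖v‖ :=
  (abs_real_inner_le_norm _ _).trans (mul_le_of_le_one_right (norm_nonneg _) (norm_eR_le_one x))

/-- **Scaling and translation covariance of bounded-drift swirl pairs** (KNSS 2009, p. 10,
(5.11)–(5.13), with a bounded drift: `F(t* + λ²(s−T), z̄e_z + λy)`, `λV(…)` again solve the swirl
equation (5.10) off the axis; `|F| ≤ C_f` is kept, the drift bounds are multiplied by `λ`).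
The pair lives up to the time `T + (τ − t*)/λ²`. [cite: KochNadirashviliSereginSverak2009, proof of Thm 5.3, (5.11)–(5.13) (arXiv p. 10)] -/
theorem rescale
    (hF : ∀ t < τ, ContDiff ℝ ∞ (F t))
    (hFd : ContinuousOn (fun p : ℝ × (EuclideanSpace ℝ (Fin 3)) => fderiv ℝ (F p.1) p.2) (Iio τ ×ˢ univ))
    (hFΔ : ContinuousOn (fun p : ℝ × (EuclideanSpace ℝ (Fin 3)) => (Δ (F p.1)) p.2) (Iio τ ×ˢ univ))
    (hFa : ∀ t < τ, IsAxisymmetricScalar (F t))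
    (hF0 : ∀ t < τ, ∀ x, cylRadius x = 0 → F t x = 0)
    (hFb : ∀ t < τ, ∀ x, |F t x| ≤ Cf)
    (hVm : Measurable (uncurry V))
    (hVs : ∀ t < τ, ContDiff ℝ ∞ (V t))
    (hVdiv : ∀ t < τ, VectorCalculus.IsDivFree (V t))
    (hVb : ∀ t < τ, ∀ x, ‖V t x‖ ≤ Cu)
    (hVr : ∀ t < τ, ∀ x, |⟪V t x, eR x⟫| ≤ Cr)
    (heq : ∀ x, cylRadius x ≠ 0 → ∀ s t : ℝ, s ≤ t → t < τ →
      F t x - F s x = ∫ r in s..t, ((Δ (F r)) x - fderiv ℝ (F r) x (V r x) -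
        2 / cylRadius x * partialDeriv (eR x) (F r) x))
    {lam : ℝ} (hlam : 0 < lam) (tstar zbar T : ℝ) :
    let F' := stPull (lam ^ 2) lam (tstar - lam ^ 2 * T) (zbar • eZ) F
    let V' := lam • stPull (lam ^ 2) lam (tstar - lam ^ 2 * T) (zbar • eZ) V
    let τ' := T + (τ - tstar) / lam ^ 2
    (∀ s < τ', ContDiff ℝ ∞ (F' s)) ∧
    ContinuousOn (fun p : ℝ × (EuclideanSpace ℝ (Fin 3)) => fderiv ℝ (F' p.1) p.2) (Iio τ' ×ˢ univ) ∧
    ContinuousOn (fun p : ℝ × (EuclideanSpace ℝ (Fin 3)) => (Δ (F' p.1)) p.2) (Iio τ' ×ˢ univ) ∧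
    (∀ s < τ', IsAxisymmetricScalar (F' s)) ∧
    (∀ s < τ', ∀ y, cylRadius y = 0 → F' s y = 0) ∧
    (∀ s < τ', ∀ y, |F' s y| ≤ Cf) ∧
    Measurable (uncurry V') ∧
    (∀ s < τ', ContDiff ℝ ∞ (V' s)) ∧
    (∀ s < τ', VectorCalculus.IsDivFree (V' s)) ∧
    (∀ s < τ', ∀ y, ‖V' s y‖ ≤ lam * Cu) ∧
    (∀ s < τ', ∀ y, |⟪V' s y, eR y⟫| ≤ lam * Cr) ∧
    (∀ y, cylRadius y ≠ 0 → ∀ s t : ℝ, s ≤ t → t < τ' →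
      F' t y - F' s y = ∫ r in s..t, ((Δ (F' r)) y - fderiv ℝ (F' r) y (V' r y) -
        2 / cylRadius y * partialDeriv (eR y) (F' r) y)) := by
  intro F' V' τ'
  set β : ℝ := lam ^ 2 with hβ
  set t₀ : ℝ := tstar - lam ^ 2 * T with ht₀
  set x₀ : (EuclideanSpace ℝ (Fin 3)) := zbar • eZ with hx₀
  have hβpos : 0 < β := by positivity
  have hlam0 : lam ≠ 0 := hlam.ne'
  -- the time correspondence
  have htime : ∀ s, s < τ' ↔ t₀ + β * s < τ := by
    intro s
    show s < T + (τ - tstar) / lam ^ 2 ↔ _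
    rw [ht₀, hβ]
    constructor
    · intro hs
      have := (lt_div_iff₀ (by positivity : (0 : ℝ) < lam ^ 2)).1 (by linarith : s - T < (τ - tstar) / lam ^ 2)
      nlinarith
    · intro hs
      have h1 : (s - T) * lam ^ 2 < τ - tstar := by nlinarith
      have := (lt_div_iff₀ (by positivity : (0 : ℝ) < lam ^ 2)).2 h1
      linarith
  -- the space correspondence
  have hX : ∀ y : (EuclideanSpace ℝ (Fin 3)), cylRadius (x₀ + lam • y) = lam * cylRadius y := fun y => by
    rw [hx₀, cylRadius_smul_eZ_add_smul, abs_of_pos hlam]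
  have heRX : ∀ y : (EuclideanSpace ℝ (Fin 3)), eR (x₀ + lam • y) = eR y := fun y => eR_smul_eZ_add_smul zbar hlam y
  -- the affine map as a continuous map of `ℝ × ℝ³`
  have hΦc : Continuous fun p : ℝ × (EuclideanSpace ℝ (Fin 3)) => (t₀ + β * p.1, x₀ + lam • p.2) := by fun_prop
  have hΦmaps : MapsTo (fun p : ℝ × (EuclideanSpace ℝ (Fin 3)) => (t₀ + β * p.1, x₀ + lam • p.2))
      (Iio τ' ×ˢ univ) (Iio τ ×ˢ univ) :=
    fun p hp => ⟨(htime p.1).1 hp.1, mem_univ _⟩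
  have hF'def : F' = stPull β lam t₀ x₀ F := rfl
  have hV'def : V' = lam • stPull β lam t₀ x₀ V := rfl
  refine ⟨?_, ?_, ?_, ?_, ?_, ?_, ?_, ?_, ?_, ?_, ?_, ?_⟩
  · -- smooth slices
    intro s hs
    have hf := hF _ ((htime s).1 hs)
    exact hf.comp (contDiff_const.add (contDiff_const_smul lam))
  · -- `∇F'` jointly continuous
    have hc := (hFd.comp hΦc.continuousOn hΦmaps).const_smul lam
    refine hc.congr fun p _ => ?_
    simp only [Pi.smul_apply, comp_apply]
    exact fderiv_stPull β lam t₀ x₀ F p.1 p.2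
  · -- `ΔF'` jointly continuous
    have hc := (hFΔ.comp hΦc.continuousOn hΦmaps).const_smul (lam ^ 2)
    refine hc.congr fun p hp => ?_
    have h2 : ContDiff ℝ 2 (F (t₀ + β * p.1)) :=
      (hF _ ((htime p.1).1 hp.1)).of_le (by norm_cast)
    simp only [Pi.smul_apply, comp_apply, smul_eq_mul]
    rw [hF'def, laplacian_stPull β lam t₀ x₀ F p.1 p.2 h2, smul_eq_mul]
  · -- axisymmetric
    intro s hs θ y
    simp only [hF'def, stPull_apply]
    rw [hx₀, ← SereginSverak2009.rotZ_smul_eZ_add_smul, hFa _ ((htime s).1 hs) θ]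
  · -- zero on the axis
    intro s hs y hy
    simp only [hF'def, stPull_apply]
    exact hF0 _ ((htime s).1 hs) _ (by rw [hX, hy, mul_zero])
  · -- bounded
    intro s hs y
    simp only [hF'def, stPull_apply]
    exact hFb _ ((htime s).1 hs) _
  · -- measurable drift
    have hm : Measurable fun p : ℝ × (EuclideanSpace ℝ (Fin 3)) => (t₀ + β * p.1, x₀ + lam • p.2) := hΦc.measurable
    have hunc : uncurry V' = fun p : ℝ × (EuclideanSpace ℝ (Fin 3)) => lam • uncurry V (t₀ + β * p.1, x₀ + lam • p.2) := by
      funext p; rfl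
    rw [hunc]
    exact (hVm.comp hm).const_smul lam
  · -- smooth drift slices
    intro s hs
    have hu := hVs _ ((htime s).1 hs)
    have hfun : V' s = fun y => lam • V (t₀ + β * s) (x₀ + lam • y) := by
      funext y; rfl
    rw [hfun]
    exact (hu.comp (contDiff_const.add (contDiff_const_smul lam))).const_smul lam
  · -- divergence free
    intro s hs y
    have hfun : V' s = lam • stPull β lam t₀ x₀ V s := rfl
    rw [hfun]
    have hd : DifferentiableAt ℝ (stPull β lam t₀ x₀ V s) y := by
      have hu := hVs _ ((htime s).1 hs)
      exact ((hu.comp (contDiff_const.add (contDiff_const_smul lam))).differentiable (by simp)) y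
    rw [VectorCalculus.divergence, fderiv_const_smul hd, ContinuousLinearMap.toLinearMap_smul,
      LinearMap.map_smul, smul_eq_mul]
    have := divergence_stPull β lam t₀ x₀ V s y
    rw [VectorCalculus.divergence] at this
    rw [this, hVdiv _ ((htime s).1 hs) _, mul_zero, mul_zero]
  · -- drift bound `‖V'‖ ≤ λ C_u`
    intro s hs y
    rw [hV'def, smul_stPull_apply, norm_smul, Real.norm_eq_abs, abs_of_pos hlam]
    exact mul_le_mul_of_nonneg_left (hVb _ ((htime s).1 hs) _) hlam.le
  · -- radial drift bound `|⟪V', e_r⟫| ≤ λ C_r`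
    intro s hs y
    rw [hV'def, smul_stPull_apply, real_inner_smul_left, abs_mul, abs_of_pos hlam, ← heRX y]
    exact mul_le_mul_of_nonneg_left (hVr _ ((htime s).1 hs) _) hlam.le
  · -- the equation: substitute `τ'' = t₀ + β σ` in the time integral
    intro y hy s t hst ht
    have hyX : cylRadius (x₀ + lam • y) ≠ 0 := by rw [hX]; exact mul_ne_zero hlam0 hy
    set X : (EuclideanSpace ℝ (Fin 3)) := x₀ + lam • y with hXdef
    set G : ℝ → ℝ := fun τ'' => (Δ (F τ'')) X - fderiv ℝ (F τ'') X (V τ'' X) -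
      2 / cylRadius X * partialDeriv (eR X) (F τ'') X with hG
    have hst' : t₀ + β * s ≤ t₀ + β * t := by nlinarith
    have hsrc : F (t₀ + β * t) X - F (t₀ + β * s) X = ∫ τ'' in (t₀ + β * s)..(t₀ + β * t), G τ'' :=
      heq X hyX (t₀ + β * s) (t₀ + β * t) hst' ((htime t).1 ht)
    have hint : EqOn (fun σ => (Δ (F' σ)) y - fderiv ℝ (F' σ) y (V' σ y) -
          2 / cylRadius y * partialDeriv (eR y) (F' σ) y)
        (fun σ => β * G (t₀ + β * σ)) (uIcc s t) := by
      intro σ hσ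
      rw [uIcc_of_le hst] at hσ
      have hσ' : t₀ + β * σ < τ := lt_of_le_of_lt (by nlinarith [hσ.2]) ((htime t).1 ht)
      have h2 : ContDiff ℝ 2 (F (t₀ + β * σ)) := (hF _ hσ').of_le (by norm_cast)
      simp only [hG, hF'def, hV'def, smul_stPull_apply]
      rw [laplacian_stPull β lam t₀ x₀ F σ y h2, partialDeriv_apply, partialDeriv_apply,
        fderiv_stPull, heRX, hX]
      simp only [_root_.smul_apply, map_smul, smul_eq_mul, hβ]
      rw [← hXdef]
      field_simp
    have hlhs : F' t y - F' s y = F (t₀ + β * t) X - F (t₀ + β * s) X := rfl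
    have hsub := intervalIntegral.smul_integral_comp_add_mul (a := s) (b := t) G β t₀
    rw [hlhs, hsrc, intervalIntegral.integral_congr hint, intervalIntegral.integral_const_mul,
      ← hsub, smul_eq_mul]

end Rescale

/-! ### Joint continuity of the scalar -/

section JointCont

/-- **The scalar of a pair is jointly continuous** on `(−∞, τ) × ℝ³`: since it vanishes on the
axis, `F(t, x) = ∫₀¹ DF(t, θx)[x] dθ`, a parametric integral of a jointly continuous integrand
(the tree's `IsKNSSSwirlPair.continuousOn_uncurry`, which does not use the drift). [folklore] -/
theorem continuousOn_uncurry
    (hF : ∀ t < τ, ContDiff ℝ ∞ (F t))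
    (hFd : ContinuousOn (fun p : ℝ × (EuclideanSpace ℝ (Fin 3)) => fderiv ℝ (F p.1) p.2) (Iio τ ×ˢ univ))
    (hF0 : ∀ t < τ, ∀ x, cylRadius x = 0 → F t x = 0) :
    ContinuousOn (uncurry F) (Iio τ ×ˢ univ) := by
  set S : Set (ℝ × (EuclideanSpace ℝ (Fin 3))) := Iio τ ×ˢ univ with hS
  have hrep : ∀ p ∈ S, uncurry F p = ∫ θ in (0 : ℝ)..1, fderiv ℝ (F p.1) (θ • p.2) p.2 := by
    rintro ⟨t, x⟩ ⟨ht, -⟩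
    have hd : Differentiable ℝ (F t) := (hF t ht).differentiable (by simp)
    have hg : ∀ θ, HasDerivAt (fun θ : ℝ => F t (θ • x)) (fderiv ℝ (F t) (θ • x) x) θ := by
      intro θ
      have h1 : HasDerivAt (fun θ : ℝ => θ • x) x θ := by
        simpa using (hasDerivAt_id θ).smul_const x
      exact (hd (θ • x)).hasFDerivAt.comp_hasDerivAt θ h1
    have hc : Continuous fun θ : ℝ => fderiv ℝ (F t) (θ • x) x :=
      (((hF t ht).continuous_fderiv (by simp)).comp (continuous_id.smul continuous_const)).clm_apply
        continuous_const
    rw [intervalIntegral.integral_eq_sub_of_hasDerivAt (fun θ _ => hg θ) (hc.intervalIntegrable _ _)]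
    simp only [uncurry_apply_pair, one_smul, zero_smul]
    rw [hF0 t ht 0 (by simp [cylRadius]), sub_zero]
  have hcont : ContinuousOn (fun p : ℝ × (EuclideanSpace ℝ (Fin 3)) => ∫ θ in (0 : ℝ)..1, fderiv ℝ (F p.1) (θ • p.2) p.2) S := by
    rw [continuousOn_iff_continuous_restrict]
    have hH : Continuous (uncurry fun (q : S) (θ : ℝ) => fderiv ℝ (F q.1.1) (θ • q.1.2) q.1.2) := by
      have hmap : Continuous fun z : S × ℝ => ((z.1.1.1, z.2 • z.1.1.2) : ℝ × (EuclideanSpace ℝ (Fin 3))) := by fun_prop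
      have hmaps : ∀ z : S × ℝ, ((z.1.1.1, z.2 • z.1.1.2) : ℝ × (EuclideanSpace ℝ (Fin 3))) ∈ S := fun z =>
        ⟨z.1.2.1, mem_univ _⟩
      have h1 : Continuous fun z : S × ℝ => fderiv ℝ (F z.1.1.1) (z.2 • z.1.1.2) :=
        hFd.comp_continuous hmap hmaps
      exact h1.clm_apply (by fun_prop)
    exact intervalIntegral.continuous_parametric_intervalIntegral_of_continuous' hH 0 1
  exact hcont.congr hrep

end JointCont

/-! ### The data of Lemma 2.1 on a region away from the axis -/

section Lemma21Data

/-- **The hypotheses of KNSS's Lemma 2.1 for a bounded-drift pair on a region away from the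
axis** (the tree's `IsKNSSSwirlPair.lemma21_data` with a bounded drift: on `Ω ⊆ {r > ρ}`,
`ρ > 0`, the merged drift `b = V + (2/r)e_r` of the swirl equation (5.10) is jointly measurable
and bounded by `C_u + 2/ρ`, and `g = F + m` is in the elementary solution class of
`KNSS2009_lemma21` on `(0, T] × Ω` with drift `b`, whenever `T < τ`). [cite: KochNadirashviliSereginSverak2009, Lemma 2.1 (arXiv p. 5) and proof of Thm 5.3, (5.10), (5.14) (p. 10)] -/
theorem lemma21_data
    (hF : ∀ t < τ, ContDiff ℝ ∞ (F t))
    (hFd : ContinuousOn (fun p : ℝ × (EuclideanSpace ℝ (Fin 3)) => fderiv ℝ (F p.1) p.2) (Iio τ ×ˢ univ))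
    (hFΔ : ContinuousOn (fun p : ℝ × (EuclideanSpace ℝ (Fin 3)) => (Δ (F p.1)) p.2) (Iio τ ×ˢ univ))
    (hVm : Measurable (uncurry V))
    (hVb : ∀ t < τ, ∀ x, ‖V t x‖ ≤ Cu)
    (heq : ∀ x, cylRadius x ≠ 0 → ∀ s t : ℝ, s ≤ t → t < τ →
      F t x - F s x = ∫ r in s..t, ((Δ (F r)) x - fderiv ℝ (F r) x (V r x) -
        2 / cylRadius x * partialDeriv (eR x) (F r) x))
    {T : ℝ} (hT : T < τ) (m : ℝ) {ρ : ℝ} (hρ : 0 < ρ) {Ω : Set (EuclideanSpace ℝ (Fin 3))} (hΩ : ∀ y ∈ Ω, ρ < cylRadius y) :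
    Measurable (uncurry fun s y => V s y + (2 / cylRadius y) • eR y) ∧
    (∀ s ∈ Ioc 0 T, ∀ y ∈ Ω, ‖V s y + (2 / cylRadius y) • eR y‖ ≤ Cu + 2 / ρ) ∧
    (∀ s ∈ Ioc 0 T, ContDiffOn ℝ 2 (fun y => F s y + m) Ω) ∧
    ContinuousOn (fun p : ℝ × (EuclideanSpace ℝ (Fin 3)) => fderiv ℝ (fun y => F p.1 y + m) p.2) (Ioc 0 T ×ˢ Ω) ∧
    ContinuousOn (fun p : ℝ × (EuclideanSpace ℝ (Fin 3)) => (Δ fun y => F p.1 y + m) p.2) (Ioc 0 T ×ˢ Ω) ∧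
    (∀ y ∈ Ω, ∀ s t : ℝ, 0 < s → s ≤ t → t ≤ T →
      (F t y + m) - (F s y + m) = ∫ r in s..t, ((Δ fun y => F r y + m) y -
        fderiv ℝ (fun y => F r y + m) y (V r y + (2 / cylRadius y) • eR y))) := by
  have hτ : ∀ s ∈ Ioc (0 : ℝ) T, s < τ := fun s hs => lt_of_le_of_lt hs.2 hT
  have hsub : Ioc (0 : ℝ) T ×ˢ Ω ⊆ Iio τ ×ˢ (univ : Set (EuclideanSpace ℝ (Fin 3))) := fun p hp => ⟨hτ p.1 hp.1, mem_univ _⟩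
  refine ⟨?_, ?_, ?_, ?_, ?_, ?_⟩
  · have h1 : Measurable fun p : ℝ × (EuclideanSpace ℝ (Fin 3)) => (2 / cylRadius p.2) • eR p.2 :=
      ((measurable_const.div continuous_cylRadius.measurable).comp measurable_snd).smul
        (measurable_eR.comp measurable_snd)
    exact hVm.add h1
  · intro s hs y hy
    have hr := hΩ y hy
    have hr0 : 0 < cylRadius y := hρ.trans hr
    have hV : ‖V s y‖ ≤ Cu := hVb s (hτ s hs) y
    have hE : ‖(2 / cylRadius y) • eR y‖ ≤ 2 / ρ := by
      rw [norm_smul, Real.norm_eq_abs, abs_of_nonneg (by positivity)]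
      have h1 : 2 / cylRadius y ≤ 2 / ρ := div_le_div_of_nonneg_left zero_le_two hρ hr.le
      have h2 := norm_eR_le_one y
      calc 2 / cylRadius y * ‖eR y‖ ≤ 2 / ρ * 1 := by gcongr
        _ = 2 / ρ := by ring
    exact (norm_add_le _ _).trans (by linarith)
  · intro s hs
    exact (((hF s (hτ s hs)).of_le (by norm_cast)).add contDiff_const).contDiffOn
  · refine (hFd.mono hsub).congr fun p _ => ?_
    exact fderiv_add_const m
  · refine (hFΔ.mono hsub).congr fun p hp => ?_
    exact laplacian_add_const ((hF p.1 (hτ p.1 hp.1)).of_le (by norm_cast)).contDiffAt m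
  · intro y hy s t hs hst htT
    have hr := hΩ y hy
    have hy0 : cylRadius y ≠ 0 := (hρ.trans hr).ne'
    have ht : t < τ := lt_of_le_of_lt htT hT
    rw [add_sub_add_right_eq_sub, heq y hy0 s t hst ht]
    refine intervalIntegral.integral_congr fun r hr' => ?_
    rw [uIcc_of_le hst] at hr'
    have hrτ : r < τ := lt_of_le_of_lt (hr'.2.trans htT) hT
    have h2 : ContDiffAt ℝ 2 (F r) y := ((hF r hrτ).of_le (by norm_cast)).contDiffAt
    simp only [laplacian_add_const h2, fderiv_add_const, map_add, map_smul, smul_eq_mul,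
      partialDeriv_apply]
    ring

end Lemma21Data

/-! ### The slice identity -/

section Identity

/-- **The slice identity** for a bounded-drift pair (KNSS 2009, (5.15)/(5.17)/(5.19) on one time
slice; the tree's `IsKNSSSwirlPair.slice_identity`, whose proof does not use the drift bound):
`∫ (F − M)(Dφ[V] + Δφ) dy + ∫ (2/r) F Dφ[e_r] dy = ∫ (ΔF − DF[V] − (2/r)∂ᵣF) φ dy` for the
cut-off `φ = φ_{L,T}(s, ·)`. [cite: KochNadirashviliSereginSverak2009, proof of Thm 5.3, (5.15)–(5.19) (arXiv p. 10)] -/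
theorem slice_identity
    (hF : ∀ t < τ, ContDiff ℝ ∞ (F t))
    (hFa : ∀ t < τ, IsAxisymmetricScalar (F t))
    (hF0 : ∀ t < τ, ∀ x, cylRadius x = 0 → F t x = 0)
    (hVs : ∀ t < τ, ContDiff ℝ ∞ (V t))
    (hVdiv : ∀ t < τ, VectorCalculus.IsDivFree (V t))
    {s : ℝ} (hs : s < τ) (L T M : ℝ) :
    (∫ y, (F s y - M) * (fderiv ℝ (phiCut L T s) y (V s y) + (Δ (phiCut L T s)) y)) +
      ∫ y, 2 / cylRadius y * (F s y * fderiv ℝ (phiCut L T s) y (eR y)) =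
    ∫ y, ((Δ (F s)) y - fderiv ℝ (F s) y (V s y) -
      2 / cylRadius y * partialDeriv (eR y) (F s) y) * phiCut L T s y := by
  set φ := phiCut L T s with hφ
  have hφs : ContDiff ℝ 2 φ := contDiff_phiCut L T s
  have hφc : HasCompactSupport φ := hasCompactSupport_phiCut L T s
  have hF2 : ContDiff ℝ 2 (F s) := (hF s hs).of_le (by norm_cast)
  have hF1 : ContDiff ℝ 1 (F s) := (hF s hs).of_le (by norm_cast)
  have hV1 : ContDiff ℝ 1 (V s) := (hVs s hs).of_le (by norm_cast)
  have hcF : Continuous (F s) := hF1.continuous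
  have hcFM : Continuous fun y => F s y - M := hcF.sub continuous_const
  have hcDφV : Continuous fun y => fderiv ℝ φ y (V s y) :=
    (hφs.continuous_fderiv (by norm_num)).clm_apply hV1.continuous
  have hcΔφ : Continuous (Δ φ) := continuous_laplacian hφs
  have hcΔF : Continuous (Δ (F s)) := continuous_laplacian hF2
  have hcDFV : Continuous fun y => fderiv ℝ (F s) y (V s y) :=
    (hF1.continuous_fderiv one_ne_zero).clm_apply hV1.continuous
  have hcφ : Continuous φ := hφs.continuous
  have hi1 : Integrable fun y => (F s y - M) * fderiv ℝ φ y (V s y) :=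
    (hcFM.mul hcDφV).integrable_of_hasCompactSupport
      (HasCompactSupport.fderiv_apply_fun hφc (V s)).mul_left
  have hi2 : Integrable fun y => (F s y - M) * (Δ φ) y :=
    (hcFM.mul hcΔφ).integrable_of_hasCompactSupport (HasCompactSupport.laplacian_fun hφc).mul_left
  have hi3 : Integrable fun y => (Δ (F s)) y * φ y :=
    (hcΔF.mul hcφ).integrable_of_hasCompactSupport hφc.mul_left
  have hi4 : Integrable fun y => fderiv ℝ (F s) y (V s y) * φ y :=
    (hcDFV.mul hcφ).integrable_of_hasCompactSupport hφc.mul_left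
  obtain ⟨hi5, hi6, haxis⟩ := integrable_and_integral_two_div_cylRadius_mul_fderiv_eR hF1
    (hφs.of_le (by norm_num)) hφc (hFa s hs) (isAxisymmetricScalar_phiCut L T s) (hF0 s hs)
  have hconv := integral_sub_const_mul_fderiv_apply_eq hV1 (hVdiv s hs) hF1 (hφs.of_le (by norm_num)) hφc M
  have hgreen := integral_sub_const_mul_laplacian_eq hF2 hφs hφc M
  have hL : ∫ y, (F s y - M) * (fderiv ℝ φ y (V s y) + (Δ φ) y) =
      (∫ y, (F s y - M) * fderiv ℝ φ y (V s y)) + ∫ y, (F s y - M) * (Δ φ) y := by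
    rw [← integral_add hi1 hi2]
    exact integral_congr_ae (Eventually.of_forall fun y => by ring)
  have hi34 : Integrable fun y => (Δ (F s)) y * φ y - fderiv ℝ (F s) y (V s y) * φ y := hi3.sub hi4
  have hR : ∫ y, ((Δ (F s)) y - fderiv ℝ (F s) y (V s y) -
      2 / cylRadius y * partialDeriv (eR y) (F s) y) * φ y =
      (∫ y, (Δ (F s)) y * φ y) - (∫ y, fderiv ℝ (F s) y (V s y) * φ y) -
        ∫ y, 2 / cylRadius y * (fderiv ℝ (F s) y (eR y) * φ y) := by
    rw [← integral_sub hi3 hi4, ← integral_sub hi34 hi5]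
    refine integral_congr_ae (Eventually.of_forall fun y => ?_)
    simp only [partialDeriv_apply]
    ring
  rw [hL, hR, hconv, hgreen, haxis]
  ring

/-- **The time identity on a line off the axis** for a bounded-drift pair (KNSS 2009,
(5.15)/(5.17), the term `I`; the tree's `IsKNSSSwirlPair.time_identity` with the drift bound
`‖V‖ ≤ C_u` used for the integrability of `DF[V]` in time): for `0 ≤ T < τ` and `y` off the
axis, `∫₀ᵀ (F(s,y) − M) ∂ₛφ(s,y) ds = −∫₀ᵀ G(s,y) φ(s,y) ds`. [cite: KochNadirashviliSereginSverak2009, proof of Thm 5.3, (5.15)–(5.17) (arXiv p. 10)] -/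
theorem time_identity
    (hFd : ContinuousOn (fun p : ℝ × (EuclideanSpace ℝ (Fin 3)) => fderiv ℝ (F p.1) p.2) (Iio τ ×ˢ univ))
    (hFΔ : ContinuousOn (fun p : ℝ × (EuclideanSpace ℝ (Fin 3)) => (Δ (F p.1)) p.2) (Iio τ ×ˢ univ))
    (hVm : Measurable (uncurry V))
    (hVb : ∀ t < τ, ∀ x, ‖V t x‖ ≤ Cu)
    (heq : ∀ x, cylRadius x ≠ 0 → ∀ s t : ℝ, s ≤ t → t < τ →
      F t x - F s x = ∫ r in s..t, ((Δ (F r)) x - fderiv ℝ (F r) x (V r x) -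
        2 / cylRadius x * partialDeriv (eR x) (F r) x))
    {L T : ℝ} (hT0 : 0 ≤ T) (hTτ : T < τ) (M : ℝ) {y : (EuclideanSpace ℝ (Fin 3))} (hy : cylRadius y ≠ 0) :
    ∫ s in (0 : ℝ)..T, (F s y - M) * (psiCut L y * deriv (zetaCut T) s) =
      -∫ s in (0 : ℝ)..T, swirlEqnIntegrand F V s y * phiCut L T s y := by
  have hτ' : ∀ s ∈ Icc (0 : ℝ) T, s < τ := fun s hs => lt_of_le_of_lt hs.2 hTτ
  have hslab : MapsTo (fun s : ℝ => ((s, y) : ℝ × (EuclideanSpace ℝ (Fin 3)))) (Icc 0 T) (Iio τ ×ˢ univ) :=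
    fun s hs => ⟨hτ' s hs, mem_univ _⟩
  have hcs : Continuous fun s : ℝ => ((s, y) : ℝ × (EuclideanSpace ℝ (Fin 3))) := by fun_prop
  have hA : ContinuousOn (fun s => (Δ (F s)) y) (Icc 0 T) := by
    have h := hFΔ.comp hcs.continuousOn hslab
    simpa only [Function.comp_def] using h
  have hB : ContinuousOn (fun s => fderiv ℝ (F s) y) (Icc 0 T) := by
    have h := hFd.comp hcs.continuousOn hslab
    simpa only [Function.comp_def] using h
  have hVm' : Measurable fun s => V s y := by
    have h : Measurable fun s : ℝ => ((s, y) : ℝ × (EuclideanSpace ℝ (Fin 3))) := measurable_id.prodMk measurable_const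
    exact hVm.comp h
  obtain ⟨KB, hKB⟩ := (isCompact_Icc (a := (0 : ℝ)) (b := T)).exists_bound_of_continuousOn hB
  have hGint : IntegrableOn (fun s => swirlEqnIntegrand F V s y) (Icc 0 T) := by
    have hA' : IntegrableOn (fun s => (Δ (F s)) y) (Icc 0 T) := hA.integrableOn_compact isCompact_Icc
    have hD' : IntegrableOn (fun s => 2 / cylRadius y * fderiv ℝ (F s) y (eR y)) (Icc 0 T) :=
      ((hB.clm_apply continuousOn_const).integrableOn_compact isCompact_Icc).const_mul _
    have hBV : IntegrableOn (fun s => fderiv ℝ (F s) y (V s y)) (Icc 0 T) := by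
      have hmeas : AEStronglyMeasurable (fun s => fderiv ℝ (F s) y (V s y))
          (volume.restrict (Icc 0 T)) := by
        have h1 : AEStronglyMeasurable (fun s => fderiv ℝ (F s) y) (volume.restrict (Icc 0 T)) :=
          hB.aestronglyMeasurable measurableSet_Icc
        have h2 : AEStronglyMeasurable (fun s => V s y) (volume.restrict (Icc 0 T)) :=
          hVm'.aestronglyMeasurable
        exact (isBoundedBilinearMap_apply (𝕜 := ℝ) (E := (EuclideanSpace ℝ (Fin 3))) (F := ℝ)).continuous.comp_aestronglyMeasurable
          (h1.prodMk h2)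
      refine Integrable.mono' (integrableOn_const (C := KB * Cu)
        (by exact measure_Icc_lt_top.ne)) hmeas ?_
      rw [ae_restrict_iff' measurableSet_Icc]
      refine Eventually.of_forall fun s hs => ?_
      have hV : ‖V s y‖ ≤ Cu := hVb s (hτ' s hs) y
      rw [Real.norm_eq_abs, ← Real.norm_eq_abs]
      exact ((fderiv ℝ (F s) y).le_opNorm _).trans (mul_le_mul (hKB s hs) hV (norm_nonneg _)
        ((norm_nonneg _).trans (hKB s hs)))
    have : IntegrableOn (fun s => (Δ (F s)) y - fderiv ℝ (F s) y (V s y) -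
        2 / cylRadius y * fderiv ℝ (F s) y (eR y)) (Icc 0 T) := (hA'.sub hBV).sub hD'
    simpa only [swirlEqnIntegrand, partialDeriv_apply] using this
  have hg : IntervalIntegrable (fun s => swirlEqnIntegrand F V s y) volume 0 T :=
    (intervalIntegrable_iff_integrableOn_Ioc_of_le hT0).2 (hGint.mono_set Ioc_subset_Icc_self)
  have hΦ : ∀ s ∈ Icc (0 : ℝ) T, F s y = F 0 y + ∫ r in (0 : ℝ)..s, swirlEqnIntegrand F V r y := by
    intro s hs
    have h := heq y hy 0 s hs.1 (hτ' s hs)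
    simp only [swirlEqnIntegrand]
    linarith
  have hψ : ContDiff ℝ 1 fun s => phiCut L T s y :=
    show ContDiff ℝ 1 (fun s => psiCut L y * zetaCut T s) from contDiff_const.mul (contDiff_zetaCut T)
  have hψ0 : phiCut L T 0 y = 0 :=
    phiCut_eq_zero_of_not_mem_Ioo (fun h => by linarith [h.1]) y
  have hψT : phiCut L T T y = 0 :=
    phiCut_eq_zero_of_not_mem_Ioo (fun h => lt_irrefl _ h.2) y
  have key := integral_sub_const_mul_deriv_eq_neg (Φ := fun s => F s y)
    (g := fun s => swirlEqnIntegrand F V s y) (ψ := fun s => phiCut L T s y) hT0 hg hΦ hψ hψ0 hψT M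
  rw [← key]
  refine intervalIntegral.integral_congr fun s _ => ?_
  simp only [(hasDerivAt_phiCut L T s y).deriv]

end Identity

/-! ### The space–time identity -/

section SpaceTime

set_option maxHeartbeats 800000 in
-- the four dominations and the two Fubini steps are long but elementary
/-- **The space–time identity** for a bounded-drift pair (KNSS 2009, (5.15)–(5.20) integrated;
the tree's `IsKNSSSwirlPair.spaceTime_identity` with a bounded drift — on the support `{r ≤ 2}`
of the cut-off `‖V‖ ≤ C_u ≤ 2C_u/r`, so the domination is unchanged): for `0 ≤ T < τ`, a constant
`M` and the cut-off `φ = φ_{L,T}`, the three space–time integrals `∫∫ (F − M) ∂ₛφ`,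
`∫∫ (F − M)(Dφ[V] + Δφ)`, `∫∫ (2/r) F Dφ[e_r]` are absolutely convergent, the inner space
integrals are integrable in time, and
`∫∫ (F − M)(∂ₛφ + V·∇φ + Δφ) dy ds = −∫∫ (2/r) F φ_{,r} dy ds`. [cite: KochNadirashviliSereginSverak2009, proof of Thm 5.3, (5.15)–(5.19) (arXiv p. 10)] -/
theorem spaceTime_identity
    (hF : ∀ t < τ, ContDiff ℝ ∞ (F t))
    (hFd : ContinuousOn (fun p : ℝ × (EuclideanSpace ℝ (Fin 3)) => fderiv ℝ (F p.1) p.2) (Iio τ ×ˢ univ))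
    (hFΔ : ContinuousOn (fun p : ℝ × (EuclideanSpace ℝ (Fin 3)) => (Δ (F p.1)) p.2) (Iio τ ×ˢ univ))
    (hFa : ∀ t < τ, IsAxisymmetricScalar (F t))
    (hF0 : ∀ t < τ, ∀ x, cylRadius x = 0 → F t x = 0)
    (hFb : ∀ t < τ, ∀ x, |F t x| ≤ Cf)
    (hVm : Measurable (uncurry V))
    (hVs : ∀ t < τ, ContDiff ℝ ∞ (V t))
    (hVdiv : ∀ t < τ, VectorCalculus.IsDivFree (V t))
    (hVb : ∀ t < τ, ∀ x, ‖V t x‖ ≤ Cu)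
    (heq : ∀ x, cylRadius x ≠ 0 → ∀ s t : ℝ, s ≤ t → t < τ →
      F t x - F s x = ∫ r in s..t, ((Δ (F r)) x - fderiv ℝ (F r) x (V r x) -
        2 / cylRadius x * partialDeriv (eR x) (F r) x))
    {L T : ℝ} (hT0 : 0 ≤ T) (hTτ : T < τ) (M : ℝ) :
    Integrable (fun s => ∫ y, (F s y - M) * (psiCut L y * deriv (zetaCut T) s))
      (volume.restrict (Ioc 0 T)) ∧
    Integrable (fun s => ∫ y, (F s y - M) *
      (fderiv ℝ (phiCut L T s) y (V s y) + (Δ (phiCut L T s)) y)) (volume.restrict (Ioc 0 T)) ∧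
    Integrable (fun s => ∫ y, 2 / cylRadius y * (F s y * fderiv ℝ (phiCut L T s) y (eR y)))
      (volume.restrict (Ioc 0 T)) ∧
    (∫ s in Ioc 0 T, ∫ y, (F s y - M) * (psiCut L y * deriv (zetaCut T) s)) +
      ∫ s in Ioc 0 T, ((∫ y, (F s y - M) *
        (fderiv ℝ (phiCut L T s) y (V s y) + (Δ (phiCut L T s)) y)) +
        ∫ y, 2 / cylRadius y * (F s y * fderiv ℝ (phiCut L T s) y (eR y))) = 0 := by
  -- nonnegativity of the constants
  have hCf : 0 ≤ Cf := (abs_nonneg _).trans (hFb (τ - 1) (by linarith) 0)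
  have hCu : 0 ≤ Cu := (norm_nonneg _).trans (hVb (τ - 1) (by linarith) 0)
  obtain ⟨Cu2, hCu2def⟩ : ∃ c : ℝ, c = 2 * Cu := ⟨_, rfl⟩
  have hCu2 : 0 ≤ Cu2 := by rw [hCu2def]; positivity
  have hFcont : ContinuousOn (uncurry F) (Iio τ ×ˢ univ) := continuousOn_uncurry hF hFd hF0
  -- the product measure and its description as a restriction
  set μT : Measure (ℝ × (EuclideanSpace ℝ (Fin 3))) := (volume.restrict (Ioc 0 T)).prod volume with hμT
  have hμT' : μT = (volume.prod volume).restrict (Ioc 0 T ×ˢ univ) :=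
    Measure.restrict_prod_eq_prod_univ _
  have hslabm : MeasurableSet (Ioc (0 : ℝ) T ×ˢ (univ : Set (EuclideanSpace ℝ (Fin 3)))) :=
    measurableSet_Ioc.prod MeasurableSet.univ
  have hsub : Ioc (0 : ℝ) T ×ˢ (univ : Set (EuclideanSpace ℝ (Fin 3))) ⊆ Iio τ ×ˢ univ :=
    fun p hp => ⟨lt_of_le_of_lt hp.1.2 hTτ, mem_univ _⟩
  have hτ' : ∀ s ∈ Ioc (0 : ℝ) T, s < τ := fun s hs => lt_of_le_of_lt hs.2 hTτ
  have hae : ∀ᵐ p ∂μT, p.1 ∈ Ioc 0 T ∧ cylRadius p.2 ≠ 0 := by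
    have h1 : ∀ᵐ p ∂μT, p ∈ Ioc (0 : ℝ) T ×ˢ (univ : Set (EuclideanSpace ℝ (Fin 3))) := by
      rw [hμT']; exact ae_restrict_mem hslabm
    have h2 : ∀ᵐ p ∂μT, cylRadius p.2 ≠ 0 :=
      (Measure.quasiMeasurePreserving_snd (μ := volume.restrict (Ioc (0 : ℝ) T))
        (ν := (volume : Measure (EuclideanSpace ℝ (Fin 3))))).ae ae_cylRadius_ne_zero
    filter_upwards [h1, h2] with p hp1 hp2
    exact ⟨hp1.1, hp2⟩
  have hAE_cont : ∀ {g : ℝ × (EuclideanSpace ℝ (Fin 3)) → ℝ}, ContinuousOn g (Iio τ ×ˢ univ) → AEStronglyMeasurable g μT := by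
    intro g hg
    rw [hμT']
    exact (hg.mono hsub).aestronglyMeasurable hslabm
  have happly : Continuous fun q : ((EuclideanSpace ℝ (Fin 3)) →L[ℝ] ℝ) × (EuclideanSpace ℝ (Fin 3)) => q.1 q.2 :=
    (isBoundedBilinearMap_apply (𝕜 := ℝ) (E := (EuclideanSpace ℝ (Fin 3))) (F := ℝ)).continuous
  have hAE_DF : ∀ {v : ℝ × (EuclideanSpace ℝ (Fin 3)) → (EuclideanSpace ℝ (Fin 3))}, Measurable v →
      AEStronglyMeasurable (fun p : ℝ × (EuclideanSpace ℝ (Fin 3)) => fderiv ℝ (F p.1) p.2 (v p)) μT := by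
    intro v hv
    have h1 : AEStronglyMeasurable (fun p : ℝ × (EuclideanSpace ℝ (Fin 3)) => fderiv ℝ (F p.1) p.2) μT := by
      rw [hμT']
      exact (hFd.mono hsub).aestronglyMeasurable hslabm
    exact happly.comp_aestronglyMeasurable (h1.prodMk hv.aestronglyMeasurable)
  have hVm' : Measurable fun p : ℝ × (EuclideanSpace ℝ (Fin 3)) => V p.1 p.2 := hVm
  have heRm : Measurable fun p : ℝ × (EuclideanSpace ℝ (Fin 3)) => eR p.2 := measurable_eR.comp measurable_snd
  have hFc : ContinuousOn (fun p : ℝ × (EuclideanSpace ℝ (Fin 3)) => F p.1 p.2 - M) (Iio τ ×ˢ univ) :=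
    hFcont.sub continuousOn_const
  have hζ'c : Continuous (deriv (zetaCut T)) := (contDiff_zetaCut T (n := 2)).continuous_deriv (by norm_num)
  have hψc : Continuous (psiCut L) := (contDiff_psiCut L (n := 0)).continuous
  have hDφc : Continuous fun p : ℝ × (EuclideanSpace ℝ (Fin 3)) => fderiv ℝ (phiCut L T p.1) p.2 := by
    have h : Continuous fun p : ℝ × (EuclideanSpace ℝ (Fin 3)) => zetaCut T p.1 • fderiv ℝ (psiCut L) p.2 :=
      ((contDiff_zetaCut T (n := 0)).continuous.comp continuous_fst).smul
        (((contDiff_psiCut L (n := 1)).continuous_fderiv one_ne_zero).comp continuous_snd)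
    exact h.congr fun p => (fderiv_phiCut_eq L T p.1 p.2).symm
  have hΔφc : Continuous fun p : ℝ × (EuclideanSpace ℝ (Fin 3)) => (Δ (phiCut L T p.1)) p.2 := by
    have h : Continuous fun p : ℝ × (EuclideanSpace ℝ (Fin 3)) => zetaCut T p.1 * (Δ (psiCut L)) p.2 :=
      ((contDiff_zetaCut T (n := 0)).continuous.comp continuous_fst).mul
        ((continuous_laplacian (contDiff_psiCut L (n := 2))).comp continuous_snd)
    exact h.congr fun p => (laplacian_phiCut_eq L T p.1 p.2).symm
  have hφc : Continuous fun p : ℝ × (EuclideanSpace ℝ (Fin 3)) => phiCut L T p.1 p.2 :=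
    (hψc.comp continuous_snd).mul ((contDiff_zetaCut T (n := 0)).continuous.comp continuous_fst)
  -- the four integrands are a.e. strongly measurable
  have hm1 : AEStronglyMeasurable (fun p : ℝ × (EuclideanSpace ℝ (Fin 3)) => (F p.1 p.2 - M) *
      (psiCut L p.2 * deriv (zetaCut T) p.1)) μT :=
    (hAE_cont hFc).mul ((hψc.comp continuous_snd).mul (hζ'c.comp continuous_fst)).aestronglyMeasurable
  have hm2 : AEStronglyMeasurable (fun p : ℝ × (EuclideanSpace ℝ (Fin 3)) => (F p.1 p.2 - M) *
      (fderiv ℝ (phiCut L T p.1) p.2 (V p.1 p.2) + (Δ (phiCut L T p.1)) p.2)) μT :=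
    (hAE_cont hFc).mul ((happly.comp_aestronglyMeasurable
      (hDφc.aestronglyMeasurable.prodMk hVm'.aestronglyMeasurable)).add hΔφc.aestronglyMeasurable)
  have hm3 : AEStronglyMeasurable (fun p : ℝ × (EuclideanSpace ℝ (Fin 3)) => 2 / cylRadius p.2 *
      (F p.1 p.2 * fderiv ℝ (phiCut L T p.1) p.2 (eR p.2))) μT := by
    have h1 : Measurable fun p : ℝ × (EuclideanSpace ℝ (Fin 3)) => 2 / cylRadius p.2 :=
      measurable_const.div (continuous_cylRadius.measurable.comp measurable_snd)
    have h2 : AEStronglyMeasurable (fun p : ℝ × (EuclideanSpace ℝ (Fin 3)) => F p.1 p.2) μT := hAE_cont hFcont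
    exact h1.aestronglyMeasurable.mul (h2.mul (happly.comp_aestronglyMeasurable
      (hDφc.aestronglyMeasurable.prodMk heRm.aestronglyMeasurable)))
  have hm4 : AEStronglyMeasurable (fun p : ℝ × (EuclideanSpace ℝ (Fin 3)) => swirlEqnIntegrand F V p.1 p.2 *
      phiCut L T p.1 p.2) μT := by
    have h1 : AEStronglyMeasurable (fun p : ℝ × (EuclideanSpace ℝ (Fin 3)) => (Δ (F p.1)) p.2) μT := by
      rw [hμT']; exact (hFΔ.mono hsub).aestronglyMeasurable hslabm
    have h2 := hAE_DF hVm'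
    have h3 := hAE_DF heRm
    have h4 : Measurable fun p : ℝ × (EuclideanSpace ℝ (Fin 3)) => 2 / cylRadius p.2 :=
      measurable_const.div (continuous_cylRadius.measurable.comp measurable_snd)
    have h : AEStronglyMeasurable (fun p : ℝ × (EuclideanSpace ℝ (Fin 3)) => ((Δ (F p.1)) p.2 - fderiv ℝ (F p.1) p.2 (V p.1 p.2)
        - 2 / cylRadius p.2 * fderiv ℝ (F p.1) p.2 (eR p.2)) * phiCut L T p.1 p.2) μT :=
      ((h1.sub h2).sub (h4.aestronglyMeasurable.mul h3)).mul hφc.aestronglyMeasurable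
    simpa only [swirlEqnIntegrand, partialDeriv_apply] using h
  -- bounds for `∇F`, `ΔF` on the compact `[0, T] × {r ≤ 2, |z| ≤ L}`
  have hKset : IsCompact (Icc (0 : ℝ) T ×ˢ solidCylinder 2 L) := isCompact_Icc.prod (isCompact_solidCylinder 2 L)
  have hKsub : Icc (0 : ℝ) T ×ˢ solidCylinder 2 L ⊆ Iio τ ×ˢ univ :=
    fun p hp => ⟨lt_of_le_of_lt hp.1.2 hTτ, mem_univ _⟩
  obtain ⟨K₁, hK₁⟩ := hKset.exists_bound_of_continuousOn (hFd.mono hKsub)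
  obtain ⟨K₂, hK₂⟩ := hKset.exists_bound_of_continuousOn (hFΔ.mono hKsub)
  set K : ℝ := max (max K₁ K₂) 0 with hK
  have hK0 : 0 ≤ K := le_max_right _ _
  have hKD : ∀ s ∈ Ioc (0 : ℝ) T, ∀ y ∈ solidCylinder 2 L, ‖fderiv ℝ (F s) y‖ ≤ K := fun s hs y hy =>
    (hK₁ (s, y) ⟨⟨hs.1.le, hs.2⟩, hy⟩).trans ((le_max_left _ _).trans (le_max_left _ _))
  have hKΔ : ∀ s ∈ Ioc (0 : ℝ) T, ∀ y ∈ solidCylinder 2 L, |(Δ (F s)) y| ≤ K := fun s hs y hy => by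
    have h := hK₂ (s, y) ⟨⟨hs.1.le, hs.2⟩, hy⟩
    rw [Real.norm_eq_abs] at h
    exact h.trans ((le_max_right _ _).trans (le_max_left _ _))
  -- bounds for the cut-off
  obtain ⟨B, hB⟩ := exists_bound_fderiv_laplacian_phiCut L T
  have hB0 : 0 ≤ B := (norm_nonneg _).trans (hB 0 0).1
  -- on the support of the cut-off the bounded drift obeys `‖V‖ ≤ Cu2 / r`
  have hVsupp : ∀ p : ℝ × (EuclideanSpace ℝ (Fin 3)), p.1 ∈ Ioc (0 : ℝ) T → p.2 ∈ solidCylinder 2 L → cylRadius p.2 ≠ 0 →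
      ‖V p.1 p.2‖ ≤ Cu2 * (cylRadius p.2)⁻¹ := by
    intro p hs hy hr0
    have hr : 0 < cylRadius p.2 := lt_of_le_of_ne (cylRadius_nonneg _) (Ne.symm hr0)
    have h1 : ‖V p.1 p.2‖ ≤ Cu := hVb p.1 (hτ' p.1 hs) p.2
    have h2 : (2 : ℝ)⁻¹ ≤ (cylRadius p.2)⁻¹ := inv_anti₀ hr hy.1
    rw [hCu2def]
    nlinarith [h1, h2, hCu]
  clear hCu2def
  -- the dominating function
  set Kd : ℝ := (Cf + |M|) * (2 * smoothTransitionC2Bound + B * (Cu2 + 1)) + 2 * Cf * B + K * (Cu2 + 2) + 1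
    with hKd
  have hKd0 : 0 ≤ Kd := by
    have := smoothTransitionC2Bound_nonneg
    positivity
  set D : ℝ × (EuclideanSpace ℝ (Fin 3)) → ℝ := fun p => Kd * (solidCylinder 2 L).indicator (fun y => (cylRadius y)⁻¹ + 1) p.2
    with hD
  have hDint : Integrable D μT := by
    have hg : Integrable (fun y : (EuclideanSpace ℝ (Fin 3)) => (solidCylinder 2 L).indicator (fun y => (cylRadius y)⁻¹ + 1) y) :=
      ((integrableOn_inv_cylRadius_solidCylinder 2 L).add (integrableOn_const (C := (1 : ℝ))
        (volume_solidCylinder_lt_top 2 L).ne)).integrable_indicator (measurableSet_solidCylinder 2 L)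
    have hf : Integrable (fun _ : ℝ => Kd) (volume.restrict (Ioc (0 : ℝ) T)) :=
      integrableOn_const (C := Kd) measure_Ioc_lt_top.ne
    exact hf.mul_prod hg
  have hDval : ∀ p : ℝ × (EuclideanSpace ℝ (Fin 3)), p.2 ∈ solidCylinder 2 L → D p = Kd * ((cylRadius p.2)⁻¹ + 1) := fun p hp => by
    simp only [hD, indicator_of_mem hp]
  have hDval' : ∀ p : ℝ × (EuclideanSpace ℝ (Fin 3)), p.2 ∉ solidCylinder 2 L → D p = 0 := fun p hp => by
    simp only [hD, indicator_of_notMem hp, mul_zero]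
  have hFM : ∀ s ∈ Ioc (0 : ℝ) T, ∀ y, |F s y - M| ≤ Cf + |M| := fun s hs y =>
    (abs_sub _ _).trans (add_le_add (hFb s (hτ' s hs) y) le_rfl)
  -- integrability of the four integrands
  have hint1 : Integrable (fun p : ℝ × (EuclideanSpace ℝ (Fin 3)) => (F p.1 p.2 - M) * (psiCut L p.2 * deriv (zetaCut T) p.1)) μT := by
    refine hDint.mono' hm1 (hae.mono fun p hp => ?_)
    obtain ⟨hs, -⟩ := hp
    by_cases hy : p.2 ∈ solidCylinder 2 L
    · rw [hDval p hy, Real.norm_eq_abs, abs_mul]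
      have h1 := hFM p.1 hs p.2
      have h2 := abs_psiCut_mul_deriv_zetaCut_le L T p.1 p.2
      have hr : 0 ≤ (cylRadius p.2)⁻¹ := inv_nonneg.2 (cylRadius_nonneg _)
      have h3 : |F p.1 p.2 - M| * |psiCut L p.2 * deriv (zetaCut T) p.1| ≤
          (Cf + |M|) * (2 * smoothTransitionC2Bound) :=
        mul_le_mul h1 h2 (abs_nonneg _) (by positivity)
      have h4 : (Cf + |M|) * (2 * smoothTransitionC2Bound) ≤ Kd := by
        have P1 : 0 ≤ (Cf + |M|) * (B * (Cu2 + 1)) := by positivity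
        have P2 : 0 ≤ 2 * Cf * B := by positivity
        have P3 : 0 ≤ K * (Cu2 + 2) := by positivity
        rw [hKd]; nlinarith [P1, P2, P3]
      nlinarith [mul_nonneg hr (mul_nonneg (abs_nonneg (F p.1 p.2 - M))
        (abs_nonneg (psiCut L p.2 * deriv (zetaCut T) p.1)))]
    · rw [hDval' p hy, (phiCut_derivs_eq_zero_of_not_mem (T := T) (s := p.1) hy).2.2.2]
      simp
  have hint2 : Integrable (fun p : ℝ × (EuclideanSpace ℝ (Fin 3)) => (F p.1 p.2 - M) *
      (fderiv ℝ (phiCut L T p.1) p.2 (V p.1 p.2) + (Δ (phiCut L T p.1)) p.2)) μT := by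
    refine hDint.mono' hm2 (hae.mono fun p hp => ?_)
    obtain ⟨hs, hr0⟩ := hp
    by_cases hy : p.2 ∈ solidCylinder 2 L
    · rw [hDval p hy, Real.norm_eq_abs, abs_mul]
      have h1 := hFM p.1 hs p.2
      have hV : ‖V p.1 p.2‖ ≤ Cu2 * (cylRadius p.2)⁻¹ := hVsupp p hs hy hr0
      have h2 : |fderiv ℝ (phiCut L T p.1) p.2 (V p.1 p.2) + (Δ (phiCut L T p.1)) p.2| ≤
          B * (Cu2 * (cylRadius p.2)⁻¹) + B := by
        refine (abs_add_le _ _).trans (add_le_add ?_ (hB p.1 p.2).2)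
        rw [← Real.norm_eq_abs]
        exact ((fderiv ℝ (phiCut L T p.1) p.2).le_opNorm _).trans (mul_le_mul (hB p.1 p.2).1 hV
          (norm_nonneg _) hB0)
      have h3 : |F p.1 p.2 - M| * |fderiv ℝ (phiCut L T p.1) p.2 (V p.1 p.2) + (Δ (phiCut L T p.1)) p.2| ≤
          (Cf + |M|) * (B * (Cu2 * (cylRadius p.2)⁻¹) + B) :=
        mul_le_mul h1 h2 (abs_nonneg _) (by positivity)
      have hri : 0 ≤ (cylRadius p.2)⁻¹ := inv_nonneg.2 (cylRadius_nonneg _)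
      have h4 : (Cf + |M|) * (B * (Cu2 * (cylRadius p.2)⁻¹) + B) ≤ Kd * ((cylRadius p.2)⁻¹ + 1) := by
        have hCS := smoothTransitionC2Bound_nonneg
        have Q1 : 0 ≤ (Cf + |M|) * B * Cu2 := by positivity
        have Q2 : 0 ≤ (Cf + |M|) * B * (cylRadius p.2)⁻¹ := by positivity
        have Q3 : 0 ≤ ((Cf + |M|) * (2 * smoothTransitionC2Bound) + 2 * Cf * B + K * (Cu2 + 2) + 1) *
            ((cylRadius p.2)⁻¹ + 1) := by positivity
        rw [hKd]; nlinarith [Q1, Q2, Q3]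
      linarith
    · rw [hDval' p hy, (phiCut_derivs_eq_zero_of_not_mem hy).2.1, (phiCut_derivs_eq_zero_of_not_mem hy).2.2.1]
      simp
  have hint3 : Integrable (fun p : ℝ × (EuclideanSpace ℝ (Fin 3)) => 2 / cylRadius p.2 *
      (F p.1 p.2 * fderiv ℝ (phiCut L T p.1) p.2 (eR p.2))) μT := by
    refine hDint.mono' hm3 (hae.mono fun p hp => ?_)
    obtain ⟨hs, -⟩ := hp
    by_cases hy : p.2 ∈ solidCylinder 2 L
    · rw [hDval p hy, Real.norm_eq_abs, abs_mul, abs_mul, abs_div, abs_two,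
        abs_of_nonneg (cylRadius_nonneg _), div_eq_mul_inv]
      have h1 : |F p.1 p.2| ≤ Cf := hFb p.1 (hτ' p.1 hs) p.2
      have h2 : |fderiv ℝ (phiCut L T p.1) p.2 (eR p.2)| ≤ B := by
        rw [← Real.norm_eq_abs]
        exact ((fderiv ℝ (phiCut L T p.1) p.2).le_opNorm _).trans
          ((mul_le_of_le_one_right (norm_nonneg _) (norm_eR_le_one _)).trans (hB p.1 p.2).1)
      have hri : 0 ≤ (cylRadius p.2)⁻¹ := inv_nonneg.2 (cylRadius_nonneg _)
      have h3 : |F p.1 p.2| * |fderiv ℝ (phiCut L T p.1) p.2 (eR p.2)| ≤ Cf * B :=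
        mul_le_mul h1 h2 (abs_nonneg _) hCf
      have h4 : 2 * (Cf * B) ≤ Kd := by
        rw [hKd]; nlinarith [smoothTransitionC2Bound_nonneg, abs_nonneg M, mul_nonneg hB0 hCu2,
          mul_nonneg hK0 hCu2, mul_nonneg hCf hB0]
      nlinarith [mul_nonneg hri (mul_nonneg (abs_nonneg (F p.1 p.2)) (abs_nonneg (fderiv ℝ (phiCut L T p.1) p.2 (eR p.2))))]
    · rw [hDval' p hy, (phiCut_derivs_eq_zero_of_not_mem hy).2.1]
      simp
  have hint4 : Integrable (fun p : ℝ × (EuclideanSpace ℝ (Fin 3)) => swirlEqnIntegrand F V p.1 p.2 * phiCut L T p.1 p.2) μT := by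
    refine hDint.mono' hm4 (hae.mono fun p hp => ?_)
    obtain ⟨hs, hr0⟩ := hp
    by_cases hy : p.2 ∈ solidCylinder 2 L
    · rw [hDval p hy, Real.norm_eq_abs, abs_mul]
      have hr : 0 < cylRadius p.2 := lt_of_le_of_ne (cylRadius_nonneg _) (Ne.symm hr0)
      have hri : 0 ≤ (cylRadius p.2)⁻¹ := inv_nonneg.2 (cylRadius_nonneg _)
      have hV : ‖V p.1 p.2‖ ≤ Cu2 * (cylRadius p.2)⁻¹ := hVsupp p hs hy hr0
      obtain ⟨φ0, φ1⟩ := phiCut_mem_Icc L T p.1 p.2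
      have hG : |swirlEqnIntegrand F V p.1 p.2| ≤ K + K * (Cu2 * (cylRadius p.2)⁻¹) +
          2 * (cylRadius p.2)⁻¹ * K := by
        simp only [swirlEqnIntegrand, partialDeriv_apply]
        refine (abs_sub _ _).trans (add_le_add ((abs_sub _ _).trans (add_le_add (hKΔ p.1 hs p.2 hy) ?_)) ?_)
        · rw [← Real.norm_eq_abs]
          exact ((fderiv ℝ (F p.1) p.2).le_opNorm _).trans (mul_le_mul (hKD p.1 hs p.2 hy) hV
            (norm_nonneg _) hK0)
        · rw [abs_mul, abs_div, abs_two, abs_of_nonneg (cylRadius_nonneg _), div_eq_mul_inv,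
            ← Real.norm_eq_abs]
          refine mul_le_mul_of_nonneg_left ?_ (by positivity)
          exact ((fderiv ℝ (F p.1) p.2).le_opNorm _).trans
            ((mul_le_of_le_one_right (norm_nonneg _) (norm_eR_le_one _)).trans (hKD p.1 hs p.2 hy))
      have h3 : |swirlEqnIntegrand F V p.1 p.2| * |phiCut L T p.1 p.2| ≤
          (K + K * (Cu2 * (cylRadius p.2)⁻¹) + 2 * (cylRadius p.2)⁻¹ * K) * 1 := by
        refine mul_le_mul hG ?_ (abs_nonneg _) (by positivity)
        rw [abs_of_nonneg φ0]; exact φ1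
      have h4 : (K + K * (Cu2 * (cylRadius p.2)⁻¹) + 2 * (cylRadius p.2)⁻¹ * K) * 1 ≤
          Kd * ((cylRadius p.2)⁻¹ + 1) := by
        have hCS := smoothTransitionC2Bound_nonneg
        have R1 : 0 ≤ K * Cu2 := by positivity
        have R2 : 0 ≤ ((Cf + |M|) * (2 * smoothTransitionC2Bound + B * (Cu2 + 1)) + 2 * Cf * B + 1) *
            ((cylRadius p.2)⁻¹ + 1) := by positivity
        have R3 : 0 ≤ K * Cu2 * (cylRadius p.2)⁻¹ := by positivity
        rw [hKd]; nlinarith [R1, R2, R3]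
      linarith
    · rw [hDval' p hy, (phiCut_derivs_eq_zero_of_not_mem hy).1]
      simp
  -- Fubini and the two identities
  refine ⟨hint1.integral_prod_left, hint2.integral_prod_left, hint3.integral_prod_left, ?_⟩
  have e1 : ∫ s in Ioc 0 T, ∫ y, (F s y - M) * (psiCut L y * deriv (zetaCut T) s) =
      ∫ y, ∫ s in Ioc 0 T, (F s y - M) * (psiCut L y * deriv (zetaCut T) s) :=
    integral_integral_swap (f := fun s y => (F s y - M) * (psiCut L y * deriv (zetaCut T) s)) hint1
  have e2 : ∀ᵐ y ∂(volume : Measure (EuclideanSpace ℝ (Fin 3))), ∫ s in Ioc 0 T, (F s y - M) * (psiCut L y * deriv (zetaCut T) s) =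
      -∫ s in Ioc 0 T, swirlEqnIntegrand F V s y * phiCut L T s y := by
    filter_upwards [ae_cylRadius_ne_zero] with y hy
    rw [← intervalIntegral.integral_of_le hT0, ← intervalIntegral.integral_of_le hT0]
    exact time_identity hFd hFΔ hVm hVb heq hT0 hTτ M hy
  have e3 : ∫ s in Ioc 0 T, ∫ y, swirlEqnIntegrand F V s y * phiCut L T s y =
      ∫ y, ∫ s in Ioc 0 T, swirlEqnIntegrand F V s y * phiCut L T s y :=
    integral_integral_swap (f := fun s y => swirlEqnIntegrand F V s y * phiCut L T s y) hint4
  have e4 : ∫ s in Ioc 0 T, ∫ y, swirlEqnIntegrand F V s y * phiCut L T s y =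
      ∫ s in Ioc 0 T, ((∫ y, (F s y - M) *
        (fderiv ℝ (phiCut L T s) y (V s y) + (Δ (phiCut L T s)) y)) +
        ∫ y, 2 / cylRadius y * (F s y * fderiv ℝ (phiCut L T s) y (eR y))) := by
    refine setIntegral_congr_fun measurableSet_Ioc fun s hs => ?_
    have h := slice_identity hF hFa hF0 hVs hVdiv (hτ' s hs) L T M
    simp only [swirlEqnIntegrand] at h ⊢
    rw [h]
  rw [← e4, e1, integral_congr_ae e2, integral_neg, ← e3]
  ring

end SpaceTime

end LRZPair

end Literature.Analysis.FluidPDE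

end
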